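import Summits.QuantumFields.YangMills.Theorems.BalabanUVNodesN12ClassLettersAtClosedClassOfRecord
import Summits.QuantumFields.YangMills.Theorems.BalabanUVNodesN21ReadSetSupport
import Summits.QuantumFields.YangMills.Theorems.BalabanUVNodesN21LocalAveragedRegularityLevels
import Literature.MathematicalPhysics.QuantumFieldTheory.Balaban1983to89.B15Claim189LambdaPin
import Literature.MathematicalPhysics.QuantumFieldTheory.Balaban1983to89.Node00.LargeFieldBackgroundCoPOfRecord
import HarnessLib

/-!
# BalabanUVNodes ∕ N12 — THE CLASS LETTERS OF THE w1 LINEAGE's CHART THEOREM, PART 3: THE GEOMETRY LETTER INHABITED AT THE RECORD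
# (`𝐁 := 𝐁_k(Z)` of [Balaban1988Convergent] (2.13), `{Ω_n} := maxDomT M₁ Z`, support `Ω₀ := suppDomOfRecord`; [Balaban1985Variational] (1) p. 277 «(L^jη)^{-1}dist(Ω_j^c, Ω_{j+1}) > RM₁»,
# (7) p. 278 «by Proposition 2 [4] the configuration V satisfies (7) with ε₁ = O(ε₀)»; [Balaban1985Averaging] Prop. 2 p. 26)

Cell `pub-ymgap` (HUMAN RULINGS D-0062 ∕ D-0149), WIDTH SEAT `pub-ymgap-dag-n12-w1` g4 (node N12 = [B15]; key K1⁹ `stmt-QuantumFields-27364`, `--kind proof --supports … --as helper`;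
count-neutral).  THEOREMS ONLY (0 `def`, 0 `instance`, 0 `sorry`); consumed BY NAME: Part 2 (`…N12ClassLettersAtClosedClassOfRecord`, cone-box packaging), dag-n21-e's torus cover ∕
collar kit (`…N21ReadSetSupport`: `feeds_witness`, `src_mem_collar_of_feeds`, `cover_mem_collar_of_within`, `within_lift_of_blockIter_eq`, `blockIter_embIter`, `collar_mono`), dag-n21-c's
chains of block centres (`…N21LocalAveragedRegularityLevels.exists_embChain`), r11's (2.11) inputs `B14Eq216Concrete.feeds` ∕ (2.13) `B14Eq213DetSet.Bj` ∕ `maxDomT` ∕ `dist_maxDomT`, def-R's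
support of record `Node00.suppDomOfRecord` = `hullD M₁ 1 Ω₁`, and `B15Claim189LambdaPin.mem_hullD_of_near`.

WHY.  Parts 1–2 discharge the three CLASS letters (`IsClosed reg'`, `closure reg ⊆ reg'`, `hDreg'`) of the lineage's chart theorems
(`B15Prop1MinimiserFamilyFromThm1AtBaseCentral.hMin_atRecord_of_node00Letters_thm1AtBase_central`, `…N12RightInverseLetterOfForest.…_central_surj`) at `reg' := closure (regMSCoPOfRecord …)`
modulo ONE combinatorial geometry letter: per constrained bond `(j, c)` a bond family through `c` closed downward under the (0.4) window and, per member `c′` of level `i + 1`, a chain of block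
centres below `emb c′₋` whose bottom fine box `boxRegion (xs 0) (Lⁱ(2L + (d+4)L + 2))` lies in the plaquette sets the class controls at the levels `j′ ≥ j − 1`.  THIS FILE inhabits that
letter at the record's objects: the bond family is the FEEDS CONE `{b | feeds i b ⊆ feeds j c}` of (2.11) (closed under the window by `mem_feeds_succ`; never empty); a cone bond of level
`i + 1` has the centre of its block within `4L^j + 3L^{i+1} − 6` of the anchor `embIter j c₋` (or `c₊`) ∈ `Ω_j` on the cover (two calls of n21-e's `feeds_witness` through a common fine
input); the bottom box then sits within `(d+14)L^j`; by [III] (2.13)'s separation (`dist_maxDomT`: within `M₁L^j − 1` of `Ω_j` lies over `Ω_{j−1}`) it lies over `Ω_{j−1}` when `2 ≤ j`, and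
in the support `hullD M₁ 1 Ω₁` when `j = 1` — both under the single floor `(d+14)·L ≤ M₁` (print: «big blocks of the size M₁L^jη», `M₁` fixed large).  With Part 2 the three class letters
become theorems at `𝐁 := Bj ν.M₁ Z k`, `reg' := closure (Node00.regMSCoPOfRecord F N ν K kc (maxDomT ν.M₁ Z))` modulo NUMERICS ONLY.

CONTENTS.  §1 feeds cone (`feeds_subset_feeds_succ_of_window`, ★ `feedsCone_closedBelow`, `mem_feedsCone_self`, `feeds_nonempty`) · §2 collar bookkeeping (`cover_mem_collar_self`,
`mem_collar_of_blockIter_eq`, `cover_lift_add_apply`) · §3 ★ `embIter_src_mem_collar_of_cone` · §4 `embIter_chain_eq_bottom`, ★ `src_mem_collar_of_mem_boxRegion_chain` · §5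
`exists_within_of_mem_collar_one`, ★ `mem_maxDomT_pred_of_mem_collar`, `coordDist_cover_le_of_within`, ★ `mem_hullD_of_mem_collar` · §6 `Bj_subset_pts_maxDomT`, `coneBox_radius_le`,
`coneBox_radius_le_side`, ★★★ `coneBox_subset_levels` · §7 ★★★ `coneBoxLetter_Bj` (Part 2's letter inhabited), ★★★ `classLetters_closure_regMSCoPOfRecord_Bj` (THE TRIPLE at the record,
modulo numerics: `0 < εreg`, `C₀(d)·2L²εreg ≤ ⅓`, `2·2L²εreg ≤ c′₂`, `(d+14)·L ≤ M₁`, `M₁L^k ∣ N₀`, `k ≤ kc + 1`), ★★★ `continuousOn_constrainedAverages_closure_regMSCoPOfRecord_Bj` (`hDreg'` alone).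

HONEST FRAMING.  Lattice geometry on the torus of record + bookkeeping over Parts 1–2; the numerics are DISPLAYED (the record's «displayed defaults» `M₁ := 1`, `εreg := 1` of
`Node00.numerics7OfRecord₁₂` do NOT meet them — they are print's «M₁ large», «ε₀ small» windows, cf. n07-e's `floorGuard`); nothing of Bałaban's estimates asserted beyond the tree's
kernel theorems ([B7] Prop. 2 local = dag-n21-c ∕ dag-n11-d); N12 NOT discharged; K1⁹ NOT closed; counts unmoved; one finite 𝕋⁴ programme at fixed ε — R4 closes the conditional rung
`BalabanLadder.UV` only; the Yang–Mills mass gap (Clay) is NOT proved by any of this; nothing continuum ∕ ℝ⁴ ∕ OS.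
-/

noncomputable section

namespace Summit.QuantumFields.YangMills.BalabanUVNodes.N12ClassLetterGeometryOfRecord

open Set
open Literature.MathematicalPhysics.QuantumFieldTheory.Balaban1983to89
open B15DeterminingSets B14.Eq213DetSet B14.Eq216Concrete B14.Eq213MaximalDomains B15Eq112TorusCover B14DomainGeom
open B14.Eq22Determines (blockIter blockIter_zero blockIter_succ)
open Literature.MathematicalPhysics.QuantumFieldTheory.Balaban1983to89.Node00 (hullD topSeq topSeq_zero topSeq_of_ne_zero suppDomOfRecord regMSCoPOfRecord
  avOfRecord SU Stage7Numerics constrCard constrEnum)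
open Literature.MathematicalPhysics.QuantumFieldTheory.Balaban1983to89.T4Continuum (T4Family)
open Literature.MathematicalPhysics.QuantumFieldTheory.Balaban1983to89.ExpMeanLog (deltaSU)
open Summit.QuantumFields.YangMills.BalabanUVNodes.N12ClassLettersAtClosedClassOfRecord (classLetters_closure_regMSCoPOfRecord_of_coneBoxes
  continuousOn_constrainedAverages_closure_regMSCoPOfRecord_of_coneBoxes)
open B8Eq17ClassAkV1 (plaqsOf)
open Summit.QuantumFields.YangMills.Theorems.N21ReadSetSupport (cover_mem_collar_of_within within_lift_of_blockIter_eq feeds_witness blockIter_embIter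
  collar_mono src_mem_collar_of_feeds)
open Summit.QuantumFields.YangMills.BalabanUVNodes.N20LCSAvgDominationRegion (boxRegion mem_boxRegion)
open Summit.QuantumFields.YangMills.Theorems.N21LocalAveragedRegularity (exists_embChain)

variable {P : Params}

/-! ## §1  The feeds cone of a bond: a bond family closed downward under the (0.4) window -/

/-- One window step: the fine inputs of a bond issuing from the blocks of `c′` feed `c′`. [cite: Balaban1988Convergent, (2.11) p.256] -/
theorem feeds_subset_feeds_succ_of_window {i : ℕ} {c' : PBond P (i + 1)} {b : PBond P i}
    (hb : blockOf b.src = c'.src ∨ blockOf b.src = c'.tgt) : feeds i b ⊆ feeds (i + 1) c' :=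
  fun _ hb₀ => mem_feeds_succ.2 ⟨b, hb, hb₀⟩

/-- ★ **THE FEEDS CONE `{b | feeds i b ⊆ feeds j c}` IS CLOSED DOWNWARD UNDER THE (0.4) WINDOW** (the bond-family shape of Part 1 ∕ Part 2). [cite: Balaban1988Convergent, (2.11) p.256] -/
theorem feedsCone_closedBelow {j : ℕ} (c : PBond P j) :
    ∀ (i : ℕ) (c' : PBond P (i + 1)), i + 1 ≤ j → c' ∈ {b : PBond P (i + 1) | feeds (i + 1) b ⊆ feeds j c} →
      ∀ b : PBond P i, (blockOf b.src = c'.src ∨ blockOf b.src = c'.tgt) → b ∈ {b : PBond P i | feeds i b ⊆ feeds j c} :=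
  fun _ _ _ hc' _ hb => (feeds_subset_feeds_succ_of_window hb).trans hc'

/-- The bond itself lies in its cone. [cite: Balaban1988Convergent, (2.11) p.256 (bookkeeping)] -/
theorem mem_feedsCone_self {j : ℕ} (c : PBond P j) : c ∈ {b : PBond P j | feeds j b ⊆ feeds j c} := fun _ h => h

/-- The fine inputs of a bond are never empty (standing range): the bond over the centre of `B(c₋)` feeds `c`. [cite: Balaban1988Convergent, (2.11) p.256] -/
theorem feeds_nonempty : ∀ {i : ℕ}, i ≤ P.m + P.K → ∀ b : PBond P i, (feeds i b).Nonempty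
  | 0, _, b => by rw [feeds_zero]; exact Set.singleton_nonempty b
  | i + 1, hi, c => by
    obtain ⟨b₀, hb₀⟩ := feeds_nonempty (i := i) (Nat.le_of_succ_le hi) ⟨emb c.src, c.dir⟩
    exact ⟨b₀, feeds_subset_feeds_succ_of_window (Or.inl (Site.blockOf_emb hi c.src)) hb₀⟩

/-! ## §2  Collar bookkeeping on the cover -/

/-- A point lies in the `0`-collar of its own unit cube: `π x₀ ∈ π(cubeExt 1 x₀ 0)`. [folklore] -/
theorem cover_mem_collar_self (x₀ : Pt P.d) : cover P x₀ ∈ cover P '' cubeExt 1 x₀ 0 :=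
  ⟨x₀, fun i => ⟨by simp, by simp⟩, rfl⟩

/-- **Same `l`-block ⇒ same collar up to `L^l − 1`**: if `a ∈ π(cubeExt s c w)` and `a′` has the same `l`-block label (standing range), then `a′ ∈ π(cubeExt s c (w + (L^l − 1)))`.
[cite: Balaban1987RG1, (0.1) p.251] -/
theorem mem_collar_of_blockIter_eq {l : ℕ} (hl : l ≤ P.m + P.K) (s : ℕ) (c : Pt P.d) {w : ℤ} {a a' : Site P 0}
    (ha : a ∈ cover P '' cubeExt s c w) (h : blockIter l a = blockIter l a') :
    a' ∈ cover P '' cubeExt s c (w + (((P.L ^ l : ℕ) : ℤ) - 1)) := by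
  have ha' : cover P (lift P a) ∈ cover P '' cubeExt s c w := by rwa [cover_lift]
  have h2 := cover_mem_collar_of_within s c ha' (within_lift_of_blockIter_eq hl h)
  rwa [cover_lift] at h2

/-- `cover (lift a + e) ν = a ν + e ν`. [folklore] -/
theorem cover_lift_add_apply (a : Site P 0) (e : Pt P.d) (ν : Fin P.d) :
    cover P (lift P a + e) ν = a ν + ((e ν : ℤ) : ZMod (P.sitesPerDir 0)) := by
  simp [cover, lift]

/-! ## §3  Where the cone bonds sit: within `4L^j + 3L^{i+1} − 6` of the anchor -/

/-- ★ **POSITION OF A CONE BOND**: if `embIter j c₋` or `embIter j c₊` lies in `π(cubeExt s a w)` and `c′` (level `i + 1 ≤ j`, standing range) lies in the feeds cone of `c`, then the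
centre `embIter (i+1) c′₋` of the block of `c′₋` lies in `π(cubeExt s a (w + 4L^j − 3 + (2L^{i+1} − 2) + (L^{i+1} − 1)))` — n21-e's `src_mem_collar_of_feeds` for a common fine input
`b₀ ∈ feeds (i+1) c′ ⊆ feeds j c`, then `feeds_witness` at `c′` read backwards. [cite: Balaban1988Convergent, (2.11) p.256; Balaban1987RG1, (0.1) p.251] -/
theorem embIter_src_mem_collar_of_cone {j : ℕ} (hj : j ≤ P.m + P.K) (s : ℕ) (a : Pt P.d) {w : ℤ} {c : PBond P j}
    (hanchor : embIter j c.src ∈ cover P '' cubeExt s a w ∨ embIter j c.tgt ∈ cover P '' cubeExt s a w)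
    {i : ℕ} (hi : i + 1 ≤ j) {c' : PBond P (i + 1)} (hc' : feeds (i + 1) c' ⊆ feeds j c) :
    embIter (i + 1) c'.src ∈ cover P '' cubeExt s a
      (w + 4 * ((P.L ^ j : ℕ) : ℤ) - 3 + (2 * ((P.L ^ (i + 1) : ℕ) : ℤ) - 2) + (((P.L ^ (i + 1) : ℕ) : ℤ) - 1)) := by
  have hi' : i + 1 ≤ P.m + P.K := hi.trans hj
  obtain ⟨b₀, hb₀⟩ := feeds_nonempty hi' c'
  have h1 : b₀.src ∈ cover P '' cubeExt s a (w + 4 * ((P.L ^ j : ℕ) : ℤ) - 3) := src_mem_collar_of_feeds hj s a (hc' hb₀) hanchor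
  obtain ⟨x', x₁', hx', hx₁', hw'⟩ := feeds_witness hi' c' b₀ hb₀
  rw [← hx₁'] at h1
  have h2 := cover_mem_collar_of_within s a h1 hw'.symm
  exact mem_collar_of_blockIter_eq hi' s a h2 (by rw [hx', blockIter_embIter hi'])

/-! ## §4  The bottom fine box of a cone bond -/

/-- The bottom of a chain of block centres is the iterated centre of every member. [cite: Balaban1987RG1, (0.1) p.251 (bookkeeping)] -/
theorem embIter_chain_eq_bottom (xs : (l : ℕ) → Site P l) {i : ℕ} (hxs : ∀ l, l < i → xs l = emb (xs (l + 1))) :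
    ∀ l, l ≤ i → embIter l (xs l) = xs 0
  | 0, _ => rfl
  | l + 1, hl => by
    show embIter l (emb (xs (l + 1))) = xs 0
    rw [← hxs l (Nat.lt_of_succ_le hl)]
    exact embIter_chain_eq_bottom xs hxs l (Nat.le_of_succ_le hl)

/-- ★ **THE POINTS OF THE BOTTOM BOX**: for a chain of block centres `xs` below `emb c′₋` (`xs i = emb c′₋`) and `embIter (i+1) c′₋ ∈ π(cubeExt s a w)`, every plaquette of the fine box
`boxRegion (xs 0) ρ` has its base point in `π(cubeExt s a (w + ρ))`. [cite: Balaban1987RG1, (0.1), (0.3) pp.251–252] -/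
theorem src_mem_collar_of_mem_boxRegion_chain (s : ℕ) (a : Pt P.d) {w : ℤ} {i : ℕ} {c' : PBond P (i + 1)}
    (xs : (l : ℕ) → Site P l) (hxi : xs i = emb c'.src) (hxs : ∀ l, l < i → xs l = emb (xs (l + 1)))
    (hc' : embIter (i + 1) c'.src ∈ cover P '' cubeExt s a w) {ρ : ℕ} {q : Plaq P 0} (hq : q ∈ boxRegion (xs 0) ρ) :
    q.src ∈ cover P '' cubeExt s a (w + (ρ : ℤ)) := by
  have hbot : xs 0 = embIter (i + 1) c'.src := by
    rw [← embIter_chain_eq_bottom xs hxs i le_rfl, hxi]; rfl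
  choose e he hqe using mem_boxRegion.mp hq
  have hq' : q.src = cover P (lift P (xs 0) + e) := funext fun ν => by rw [cover_lift_add_apply]; exact hqe ν
  have hw : Within (ρ : ℤ) (lift P (xs 0)) (lift P (xs 0) + e) := fun ν => by
    simp only [Pi.add_apply, sub_add_cancel_left, abs_neg]; exact he ν
  have h0 : cover P (lift P (xs 0)) ∈ cover P '' cubeExt s a w := by rw [cover_lift, hbot]; exact hc'
  rw [hq']
  exact cover_mem_collar_of_within s a h0 hw

/-! ## §5  Containment: the maximal sequence one level down, resp. the support of record -/

/-- Points of `π(cubeExt 1 x₀ W)` are within `W` of `x₀` on the cover. [folklore] -/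
theorem exists_within_of_mem_collar_one {x₀ : Pt P.d} {W : ℤ} {a : Site P 0} (ha : a ∈ cover P '' cubeExt 1 x₀ W) :
    ∃ y : Pt P.d, cover P y = a ∧ Within W x₀ y := by
  obtain ⟨y, hy, hya⟩ := ha
  refine ⟨y, hya, fun i => ?_⟩
  have h := hy i
  rw [abs_le]; constructor <;> push_cast at h <;> omega

/-- ★ **ONE LEVEL DOWN THE MAXIMAL SEQUENCE** ([III] (2.13) «dist(Ω_n, Ωᶜ_{n−1}) ≧ LⁿξM₁», the tree's `dist_maxDomT`): a fine site within `W ≤ M₁L^j − 1` (on the cover) of a point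
over `Ω_j`, `1 ≤ j ≤ J` (divisibility at `J`), lies over `Ω_{j−1}`. [cite: Balaban1988Convergent, (2.13) pp.256–257; Balaban1985Variational, (1) p.277] -/
theorem mem_maxDomT_pred_of_mem_collar {M₁ : ℕ} (hM : 1 ≤ M₁) {Z : Set (Site P 0)} {J : ℕ} (hdiv : side P.L M₁ J ∣ P.sitesPerDir 0)
    {j : ℕ} (hj1 : 1 ≤ j) (hjJ : j ≤ J) {x₀ : Pt P.d} (hx₀ : cover P x₀ ∈ maxDomT M₁ Z j) {W : ℤ} (hW : W ≤ ((side P.L M₁ j : ℕ) : ℤ) - 1)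
    {a : Site P 0} (ha : a ∈ cover P '' cubeExt 1 x₀ W) : a ∈ maxDomT M₁ Z (j - 1) := by
  obtain ⟨y, hya, hy⟩ := exists_within_of_mem_collar_one ha
  obtain ⟨n, rfl⟩ : ∃ n, j = n + 1 := ⟨j - 1, by omega⟩
  rw [Nat.add_sub_cancel, ← hya]
  exact dist_maxDomT hM hdiv hjJ hx₀ (hy.mono hW)

/-- Cyclic coordinate distances are bounded by cover distances. [folklore] -/
theorem coordDist_cover_le_of_within {x₀ y : Pt P.d} {W : ℕ} (h : Within (W : ℤ) x₀ y) (i : Fin P.d) :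
    B15Claim189LambdaPin.coordDist (cover P x₀) (cover P y) i ≤ W := by
  unfold B15Claim189LambdaPin.coordDist
  have hi := h i
  rw [abs_le] at hi
  by_cases he : 0 ≤ y i - x₀ i
  · -- the residue of `y − x₀`
    have h1 : (cover P y i - cover P x₀ i) = (((y i - x₀ i).toNat : ℕ) : ZMod (P.sitesPerDir 0)) := by
      rw [← Int.cast_natCast, Int.toNat_of_nonneg he]; simp only [cover]; push_cast; ring
    refine (min_le_right _ _).trans ?_
    rw [h1, ZMod.val_natCast]
    exact (Nat.mod_le _ _).trans (by omega)
  · have he' : 0 ≤ x₀ i - y i := by omega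
    have h1 : (cover P x₀ i - cover P y i) = (((x₀ i - y i).toNat : ℕ) : ZMod (P.sitesPerDir 0)) := by
      rw [← Int.cast_natCast, Int.toNat_of_nonneg he']; simp only [cover]; push_cast; ring
    refine (min_le_left _ _).trans ?_
    rw [h1, ZMod.val_natCast]
    exact (Nat.mod_le _ _).trans (by omega)

/-- ★ **INTO THE SUPPORT** (`j = 1`): a fine site within `W ≤ n·s` (on the cover) of a point of `X` lies in the `n`-layer hull `hullD P s n X` (at the record: `X = Ω₁`, `s = M₁`,
`n = 1` — the support of record `suppDomOfRecord`). [cite: Balaban1988Convergent, p.255 («a small neighborhood of Ω₁ including a layer of M₁-cubes»)] -/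
theorem mem_hullD_of_mem_collar {s n : ℕ} (hs : 0 < s) {X : Set (Site P 0)} {x₀ : Pt P.d} (hx₀ : cover P x₀ ∈ X) {W : ℕ} (hW : W ≤ n * s)
    {a : Site P 0} (ha : a ∈ cover P '' cubeExt 1 x₀ (W : ℤ)) : a ∈ hullD P s n X := by
  obtain ⟨y, hya, hy⟩ := exists_within_of_mem_collar_one ha
  rw [← hya]
  exact B15Claim189LambdaPin.mem_hullD_of_near hs hx₀ fun i => (coordDist_cover_le_of_within hy i).trans hW

/-! ## §6  The per-bond geometry letter at the (2.13) determining set `𝐁_k(Z)` and the maximal sequence -/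

/-- `Γ_j ⊆ Ω_j^{(j)}` for the (2.13) determining set at the positive scales `1 ≤ j ≤ k`. [cite: Balaban1988Convergent, (2.2) p.255, (2.13) pp.256–257] -/
theorem Bj_subset_pts_maxDomT {M₁ : ℕ} {Z : Set (Site P 0)} {k j : ℕ} (h0 : 0 < j) (hjk : j ≤ k) :
    Bj M₁ Z k j ⊆ pts j (maxDomT M₁ Z j) := by
  rcases hjk.lt_or_eq with hlt | rfl
  · rw [Bj_mid h0 hlt]; exact fun _ h => h.1
  · rw [Bj_top]

/-- Arithmetic of the radii: `4L^j − 3 + (2L^{i+1} − 2) + (L^{i+1} − 1) + Lⁱ(2L + (d+4)L + 2) ≤ (d+14)L^j` for `i + 1 ≤ j`, `2 ≤ L`. [folklore] -/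
theorem coneBox_radius_le {i j : ℕ} (hi : i + 1 ≤ j) :
    (0 : ℤ) + 4 * ((P.L ^ j : ℕ) : ℤ) - 3 + (2 * ((P.L ^ (i + 1) : ℕ) : ℤ) - 2) + (((P.L ^ (i + 1) : ℕ) : ℤ) - 1) +
        ((P.L ^ i * (2 * P.L + ((P.d + 4) * P.L + 2)) : ℕ) : ℤ) ≤ (((P.d + 14) * P.L ^ j : ℕ) : ℤ) := by
  have hL2 : 2 ≤ P.L := P.hL.2
  have h1 : P.L ^ (i + 1) ≤ P.L ^ j := Nat.pow_le_pow_right P.L_pos hi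
  have h2 : 2 * P.L ^ i ≤ P.L ^ (i + 1) := by rw [pow_succ]; nlinarith [Nat.one_le_pow i P.L P.L_pos]
  have h3 : P.L ^ i * (2 * P.L + ((P.d + 4) * P.L + 2)) = (P.d + 6) * P.L ^ (i + 1) + 2 * P.L ^ i := by ring
  rw [h3]
  push_cast
  have h1' : ((P.L : ℤ)) ^ (i + 1) ≤ (P.L : ℤ) ^ j := by exact_mod_cast h1
  have h2' : 2 * (P.L : ℤ) ^ i ≤ (P.L : ℤ) ^ (i + 1) := by exact_mod_cast h2
  have hd : (0 : ℤ) ≤ P.d := Nat.cast_nonneg _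
  nlinarith

/-- The floor `(d+14)·L ≤ M₁` gives `(d+14)L^j ≤ M₁L^j − 1` (`2 ≤ L`). [folklore] -/
theorem coneBox_radius_le_side {M₁ j : ℕ} (hfloor : (P.d + 14) * P.L ≤ M₁) :
    (((P.d + 14) * P.L ^ j : ℕ) : ℤ) ≤ ((side P.L M₁ j : ℕ) : ℤ) - 1 := by
  have hL2 : 2 ≤ P.L := P.hL.2
  have hM : P.d + 15 ≤ M₁ := by nlinarith
  have hpos : 1 ≤ P.L ^ j := Nat.one_le_pow _ _ P.L_pos
  have h : (P.d + 14) * P.L ^ j + 1 ≤ side P.L M₁ j := by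
    unfold side
    calc (P.d + 14) * P.L ^ j + 1 ≤ (P.d + 14) * P.L ^ j + P.L ^ j := by omega
      _ = (P.d + 15) * P.L ^ j := by ring
      _ ≤ M₁ * P.L ^ j := Nat.mul_le_mul_right _ hM
      _ = P.L ^ j * M₁ := by ring
  have h' : (((P.d + 14) * P.L ^ j + 1 : ℕ) : ℤ) ≤ ((side P.L M₁ j : ℕ) : ℤ) := by exact_mod_cast h
  push_cast at h' ⊢
  linarith

/-- ★★★ **THE PER-BOND GEOMETRY LETTER AT `𝐁_k(Z)` ∕ `{Ω_n}` OF (2.13)**: for a constrained bond `c` of `𝐁_k(Z)` at level `j ≤ k` (standing range, divisibility `M₁L^k ∣ N₀`), a cone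
bond `c′` of level `i + 1 ≤ j` (`feeds (i+1) c′ ⊆ feeds j c`) and the chain of block centres below `emb c′₋`, the bottom fine box `boxRegion (xs 0) (Lⁱ(2L + (d+4)L + 2))` lies in the
plaquettes of `Ω_{j−1}` (`2 ≤ j`, [III] (2.13) separation via `dist_maxDomT`) or of the support `Ω₀ ⊇ hullD M₁ 1 Ω₁` (`j = 1`), under the floor `(d+14)·L ≤ M₁` and `k ≤ kc + 1` —
i.e. in `⋃_{j′ ≤ kc, j ≤ j′+1} plaqsOf (topSeq Ω₀ {Ω_n} j′)`, the shape of Part 2's cone-box letter. [cite: Balaban1988Convergent, (2.2) p.255, (2.11)–(2.13) pp.256–257; Balaban1985Variational, (1) p.277, (7) p.279; Balaban1985Averaging, Prop. 2 p.26] -/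
theorem coneBox_subset_levels {M₁ : ℕ} (hM : 1 ≤ M₁) {k : ℕ} (hk : k ≤ P.m + P.K) (hdiv : side P.L M₁ k ∣ P.sitesPerDir 0)
    (hfloor : (P.d + 14) * P.L ≤ M₁) (Z : Set (Site P 0)) {Ω₀ : Set (Site P 0)} (hΩ₀ : hullD P M₁ 1 (maxDomT M₁ Z 1) ⊆ Ω₀)
    {kc : ℕ} (hkc : k ≤ kc + 1) {j : ℕ} (hj : j ≤ k) {c : PBond P j} (hc : c ∈ bondsOf (Bj M₁ Z k j))
    {i : ℕ} (hi : i + 1 ≤ j) {c' : PBond P (i + 1)} (hc' : feeds (i + 1) c' ⊆ feeds j c)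
    (xs : (l : ℕ) → Site P l) (hxi : xs i = emb c'.src) (hxs : ∀ l, l < i → xs l = emb (xs (l + 1))) :
    (↑(boxRegion (xs 0) (P.L ^ i * (2 * P.L + ((P.d + 4) * P.L + 2)))) : Set (Plaq P 0)) ⊆
      {q | ∃ j', j' ≤ kc ∧ j ≤ j' + 1 ∧ q ∈ plaqsOf (topSeq Ω₀ (maxDomT M₁ Z) j')} := by
  intro q hq
  have hq' : q ∈ boxRegion (xs 0) (P.L ^ i * (2 * P.L + ((P.d + 4) * P.L + 2))) := Finset.mem_coe.mp hq
  have hj0 : 0 < j := by omega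
  have hjK : j ≤ P.m + P.K := hj.trans hk
  -- the anchor `z ∈ Γ_j`, `embIter j z ∈ Ω_j`
  obtain ⟨z, hz𝔹, hzc⟩ : ∃ z, z ∈ Bj M₁ Z k j ∧ (z = c.src ∨ z = c.tgt) := by
    rcases (show c.src ∈ Bj M₁ Z k j ∨ c.tgt ∈ Bj M₁ Z k j from hc) with h | h
    exacts [⟨_, h, Or.inl rfl⟩, ⟨_, h, Or.inr rfl⟩]
  have hzΩ : embIter j z ∈ maxDomT M₁ Z j := Bj_subset_pts_maxDomT hj0 hj hz𝔹
  set x₀ : Pt P.d := lift P (embIter j z) with hx₀def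
  have hx₀ : cover P x₀ ∈ maxDomT M₁ Z j := by rw [hx₀def, cover_lift]; exact hzΩ
  have hanchor : embIter j c.src ∈ cover P '' cubeExt 1 x₀ 0 ∨ embIter j c.tgt ∈ cover P '' cubeExt 1 x₀ 0 := by
    have h := cover_mem_collar_self x₀
    rw [hx₀def, cover_lift] at h
    rcases hzc with rfl | rfl
    exacts [Or.inl h, Or.inr h]
  -- the box points sit within `(d+14)L^j` of the anchor
  have h1 := embIter_src_mem_collar_of_cone hjK 1 x₀ hanchor hi hc'
  have h2 := src_mem_collar_of_mem_boxRegion_chain 1 x₀ xs hxi hxs h1 hq'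
  have h3 : q.src ∈ cover P '' cubeExt 1 x₀ (((P.d + 14) * P.L ^ j : ℕ) : ℤ) := collar_mono 1 x₀ (coneBox_radius_le hi) h2
  rcases Nat.lt_or_ge 1 j with hj2 | hj1
  · -- `2 ≤ j`: one level down the maximal sequence
    refine ⟨j - 1, by omega, by omega, ?_⟩
    have hmem : q.src ∈ maxDomT M₁ Z (j - 1) :=
      mem_maxDomT_pred_of_mem_collar hM hdiv (by omega) hj hx₀ (coneBox_radius_le_side hfloor) h3
    rw [topSeq_of_ne_zero _ _ (by omega : j - 1 ≠ 0)]
    exact Or.inl hmem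
  · -- `j = 1`: into the support of record
    obtain rfl : j = 1 := le_antisymm hj1 hj0
    refine ⟨0, Nat.zero_le _, le_rfl, ?_⟩
    rw [topSeq_zero]
    refine Or.inl (hΩ₀ (mem_hullD_of_mem_collar (s := M₁) (n := 1) hM hx₀ (W := (P.d + 14) * P.L ^ 1) ?_ h3))
    rw [pow_one, one_mul]; exact hfloor

/-! ## §7  The class letters of E″∕I at the record's determining set, UNCONDITIONALLY in the geometry -/

section Record

variable {F : T4Family} {N : ℕ} [NeZero N] {K : ℕ}

/-- ★★★ **PART 2's CONE-BOX GEOMETRY LETTER, INHABITED AT THE RECORD** (`𝐁 := Bj ν.M₁ Z k`, `Ω := maxDomT ν.M₁ Z`, `Ω₀ := suppDomOfRecord`): the bond family is the FEEDS CONE of the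
constrained bond, the chains are dag-n21-c's `exists_embChain`, the containment is §6 — under the floor `(d+14)·L ≤ M₁`, the divisibility `M₁L^k ∣ N₀` and `k ≤ kc + 1`.
[cite: Balaban1988Convergent, (2.2) p.255, (2.11)–(2.13) pp.256–257; Balaban1985Variational, (1) p.277, (7) p.279] -/
theorem coneBoxLetter_Bj (ν : Stage7Numerics) {k : ℕ} (hk : k ≤ (F.P K).m + (F.P K).K) (hdiv : side (F.P K).L ν.M₁ k ∣ (F.P K).sitesPerDir 0)
    (hfloor : ((F.P K).d + 14) * (F.P K).L ≤ ν.M₁) (Z : Set (Site (F.P K) 0)) {kc : ℕ} (hkc : k ≤ kc + 1) :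
    ∀ j, j ≤ k → ∀ c ∈ bondsOf (Bj ν.M₁ Z k j), ∃ B : (i : ℕ) → Set (PBond (F.P K) i), c ∈ B j ∧
      (∀ (i : ℕ) (c' : PBond (F.P K) (i + 1)), i + 1 ≤ j → c' ∈ B (i + 1) →
        ∀ b : PBond (F.P K) i, (blockOf b.src = c'.src ∨ blockOf b.src = c'.tgt) → b ∈ B i) ∧
      (∀ (i : ℕ) (c' : PBond (F.P K) (i + 1)), i + 1 ≤ j → c' ∈ B (i + 1) →
        ∃ xs : (l : ℕ) → Site (F.P K) l, xs i = emb c'.src ∧ (∀ l, l < i → xs l = emb (xs (l + 1))) ∧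
          (↑(boxRegion (xs 0) ((F.P K).L ^ i * (2 * (F.P K).L + (((F.P K).d + 4) * (F.P K).L + 2)))) : Set (Plaq (F.P K) 0)) ⊆
            {q | ∃ j', j' ≤ kc ∧ j ≤ j' + 1 ∧ q ∈ plaqsOf (topSeq (suppDomOfRecord F ν K (maxDomT ν.M₁ Z)) (maxDomT ν.M₁ Z) j')}) := by
  have hM : 1 ≤ ν.M₁ := le_trans (Nat.succ_le_of_lt (Nat.mul_pos (Nat.succ_pos _) (F.P K).L_pos)) hfloor
  intro j hj c hc
  refine ⟨fun i => {b : PBond (F.P K) i | feeds i b ⊆ feeds j c}, mem_feedsCone_self c, feedsCone_closedBelow c, fun i c' hi hc' => ?_⟩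
  obtain ⟨xs, hxi, hxs⟩ := exists_embChain i (emb c'.src)
  exact ⟨xs, hxi, hxs, coneBox_subset_levels hM hk hdiv hfloor Z (Ω₀ := suppDomOfRecord F ν K (maxDomT ν.M₁ Z)) (fun _ h => h) hkc hj hc hi hc' xs hxi hxs⟩

/-- ★★★ **THE THREE CLASS LETTERS OF E″∕I AT THE RECORD — `𝐁 := Bj ν.M₁ Z k`, `reg' := closure (Node00.regMSCoPOfRecord F N ν K kc (maxDomT ν.M₁ Z))` — WITH THE GEOMETRY DISCHARGED**:
`IsClosed reg'`, `closure reg ⊆ reg'`, and `hDreg'` (the `𝐁`-restricted averages are continuous ON `reg'`), now modulo NUMERICS ONLY: `0 < εreg`, the [B7] Prop. 2 window at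
`α₀ := 2L²εreg` (`C₀(d)α₀ ≤ ⅓`, `2α₀ ≤ c′₂`), the floor `(d+14)·L ≤ M₁` (print's «big blocks», [15] (1) p.277 `R M₁`; [III] (2.13) `L^nξM₁`), the divisibility `M₁L^k ∣ N₀`, and
`k ≤ kc + 1` (constrained depth vs class depth; `kc = k` at the record). [cite: Balaban1985Variational, Thm 1 p.279, (1)–(2), (6)–(7) pp.277–279, (16)–(18) p.280; Balaban1988Convergent, (2.2) p.255, (2.11)–(2.13) pp.256–257; Balaban1985Averaging, Prop. 2 (52)–(54) p.26; Balaban1987RG1, (0.4) p.253] -/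
theorem classLetters_closure_regMSCoPOfRecord_Bj (ν : Stage7Numerics) (hε : 0 < ν.εreg) {k : ℕ} (hk : k ≤ (F.P K).m + (F.P K).K)
    (hdiv : side (F.P K).L ν.M₁ k ∣ (F.P K).sitesPerDir 0) (hfloor : ((F.P K).d + 14) * (F.P K).L ≤ ν.M₁) (Z : Set (Site (F.P K) 0))
    (kc : ℕ) (hkc : k ≤ kc + 1)
    (hα3 : (143 * (((((F.P K).d + 4 : ℕ) : ℝ)) ^ 2 / 4) ^ 2) * (2 * ((F.P K).L : ℝ) ^ 2 * ν.εreg) ≤ 1 / 3)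
    (hα2 : 2 * (2 * ((F.P K).L : ℝ) ^ 2 * ν.εreg) ≤ 2 * deltaSU (Fin N) / ((((F.P K).d + 4) * (F.P K).L : ℕ) : ℝ) ^ 2) :
    IsClosed (closure (regMSCoPOfRecord F N ν K kc (maxDomT ν.M₁ Z))) ∧
      closure (regMSCoPOfRecord F N ν K kc (maxDomT ν.M₁ Z)) ⊆ closure (regMSCoPOfRecord F N ν K kc (maxDomT ν.M₁ Z)) ∧
      ContinuousOn (fun (U : GaugeField (F.P K) 0 (SU N)) (i : Fin (constrCard (Bj ν.M₁ Z k) k)) =>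
        ((avgFamily (avOfRecord F N K) U ((constrEnum (Bj ν.M₁ Z k) k).symm i).1 ((constrEnum (Bj ν.M₁ Z k) k).symm i).2.1 : SU N) :
          Matrix (Fin N) (Fin N) ℂ))
        (closure (regMSCoPOfRecord F N ν K kc (maxDomT ν.M₁ Z))) :=
  classLetters_closure_regMSCoPOfRecord_of_coneBoxes ν hε hk kc (maxDomT ν.M₁ Z) (Bj ν.M₁ Z k) hα3 hα2 (coneBoxLetter_Bj ν hk hdiv hfloor Z hkc)

/-- ★★★ **`hDreg'` ALONE, AT THE RECORD** — the `ContinuousOn` conjunct of `classLetters_closure_regMSCoPOfRecord_Bj`, in the binder shape of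
`B15Prop1MinimiserFamilyFromThm1AtBaseCentral.hMin_atRecord_of_node00Letters_thm1AtBase_central` ∕ `…N12RightInverseLetterOfForest.…_central_surj` at `reg' := closure (regMSCoPOfRecord …)`,
`𝐁 := Bj ν.M₁ Z k`. [cite: Balaban1985Variational, (2), (6)–(7) pp.278–279, (16)–(18) p.280; Balaban1988Convergent, (2.12)–(2.13) pp.256–257; Balaban1985Averaging, Prop. 2 (52)–(54) p.26] -/
theorem continuousOn_constrainedAverages_closure_regMSCoPOfRecord_Bj (ν : Stage7Numerics) (hε : 0 < ν.εreg) {k : ℕ} (hk : k ≤ (F.P K).m + (F.P K).K)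
    (hdiv : side (F.P K).L ν.M₁ k ∣ (F.P K).sitesPerDir 0) (hfloor : ((F.P K).d + 14) * (F.P K).L ≤ ν.M₁) (Z : Set (Site (F.P K) 0))
    (kc : ℕ) (hkc : k ≤ kc + 1)
    (hα3 : (143 * (((((F.P K).d + 4 : ℕ) : ℝ)) ^ 2 / 4) ^ 2) * (2 * ((F.P K).L : ℝ) ^ 2 * ν.εreg) ≤ 1 / 3)
    (hα2 : 2 * (2 * ((F.P K).L : ℝ) ^ 2 * ν.εreg) ≤ 2 * deltaSU (Fin N) / ((((F.P K).d + 4) * (F.P K).L : ℕ) : ℝ) ^ 2) :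
    ContinuousOn (fun (U : GaugeField (F.P K) 0 (SU N)) (i : Fin (constrCard (Bj ν.M₁ Z k) k)) =>
      ((avgFamily (avOfRecord F N K) U ((constrEnum (Bj ν.M₁ Z k) k).symm i).1 ((constrEnum (Bj ν.M₁ Z k) k).symm i).2.1 : SU N) :
        Matrix (Fin N) (Fin N) ℂ))
      (closure (regMSCoPOfRecord F N ν K kc (maxDomT ν.M₁ Z))) :=
  continuousOn_constrainedAverages_closure_regMSCoPOfRecord_of_coneBoxes ν hε hk kc (maxDomT ν.M₁ Z) (Bj ν.M₁ Z k) hα3 hα2 (coneBoxLetter_Bj ν hk hdiv hfloor Z hkc)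

end Record

end Summit.QuantumFields.YangMills.BalabanUVNodes.N12ClassLetterGeometryOfRecord

end
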